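import Mathlib

/-!
# LangWeilTransfer, support item `TameResolution` (stmt-ValiantsHypothesis-6378) — minimal primes
# over `(S)` in `ℚ[Y]` versus primes over `(S)` in `ℤ[Y]`

Route `LangWeilTransfer` of `ValiantsHypothesis` (conditional route; honest framing: bookkeeping,
nothing here bears on VP ≠ VNP). `TameResolution` quantifies over the minimal primes `𝔭` of
`(S) ⊂ ℚ[Y]` for integer equations `S`, while the eliminant machinery (`eliminant_identity`,
`exists_parametrisation`) is phrased over `ℤ[T][X]` with the hypothesis "`ker φ` is the only prime
between `(S)` and itself". This file transports minimality: `ℚ[Y]` is the localisation of `ℤ[Y]`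
at the non-zero integers, so a prime `𝔮 ⊂ ℤ[Y]` with `(S) ≤ 𝔮 ≤ 𝔭 ∩ ℤ[Y]` extends to a prime of
`ℚ[Y]` between `(S)` and `𝔭`, hence equals `𝔭 ∩ ℤ[Y]`.

* `eq_comap_of_le_comap_of_minimal` — the transport statement;
* `ringEquiv_minimal_transport` — the same after a ring isomorphism `Γ : ℤ[Y] ≃ B`
  (coordinate changes and the splitting `ℤ[Y] ≅ ℤ[T][X]`), in the `RingHom.ker` form used by
  `exists_parametrisation`.
-/

noncomputable section

open MvPolynomial

-- the summit and the problem share the name `ValiantsHypothesis` (D-0017 single-conjunct layout)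
set_option linter.dupNamespace false

namespace Summit.ValiantsHypothesis.ValiantsHypothesis.Theorems.LangWeilTransfer

variable {σ : Type*}

/-- **Minimality transport from `ℚ[Y]` to `ℤ[Y]`.** If `𝔭` is a minimal prime of the ideal of
`ℚ[Y]` generated by the integer polynomials `S`, then every prime `𝔮` of `ℤ[Y]` with
`(S) ≤ 𝔮 ≤ 𝔭 ∩ ℤ[Y]` equals `𝔭 ∩ ℤ[Y]`. -/
theorem eq_comap_of_le_comap_of_minimal (S : Set (MvPolynomial σ ℤ)) (𝔭 : Ideal (MvPolynomial σ ℚ))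
    (h𝔭 : 𝔭 ∈ (Ideal.span ((MvPolynomial.map (Int.castRingHom ℚ)) '' S)).minimalPrimes)
    (𝔮 : Ideal (MvPolynomial σ ℤ)) (h𝔮 : 𝔮.IsPrime) (hS𝔮 : Ideal.span S ≤ 𝔮)
    (h𝔮𝔭 : 𝔮 ≤ 𝔭.comap (MvPolynomial.map (Int.castRingHom ℚ))) :
    𝔮 = 𝔭.comap (MvPolynomial.map (Int.castRingHom ℚ)) := by
  letI : Algebra (MvPolynomial σ ℤ) (MvPolynomial σ ℚ) := MvPolynomial.algebraMvPolynomial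
  let M : Submonoid (MvPolynomial σ ℤ) := (nonZeroDivisors ℤ).map (C : ℤ →+* MvPolynomial σ ℤ)
  haveI : IsLocalization M (MvPolynomial σ ℚ) := MvPolynomial.isLocalization (nonZeroDivisors ℤ) ℚ
  have halg : (algebraMap (MvPolynomial σ ℤ) (MvPolynomial σ ℚ)) = MvPolynomial.map (Int.castRingHom ℚ) := by
    refine MvPolynomial.ringHom_ext (fun z => ?_) (fun i => ?_)
    · change MvPolynomial.map (algebraMap ℤ ℚ) (C z) = _
      simp only [eq_intCast, map_intCast]
    · change MvPolynomial.map (algebraMap ℤ ℚ) (X i) = _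
      simp only [map_X]
  have h𝔭P : 𝔭.IsPrime := h𝔭.1.1
  have hunder : 𝔭.under (MvPolynomial σ ℤ) = 𝔭.comap (MvPolynomial.map (Int.castRingHom ℚ)) := by
    rw [Ideal.under_def, halg]
  -- `𝔮` misses the non-zero integers
  have hdisj𝔭 : Disjoint (M : Set (MvPolynomial σ ℤ)) ↑(𝔭.under (MvPolynomial σ ℤ)) :=
    (IsLocalization.disjoint_under_iff M (MvPolynomial σ ℚ) 𝔭).2 h𝔭P.ne_top
  have hdisj : Disjoint (M : Set (MvPolynomial σ ℤ)) ↑𝔮 := by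
    refine hdisj𝔭.mono_right ?_
    rw [hunder]; exact h𝔮𝔭
  -- the extension `𝔮'` of `𝔮` to `ℚ[Y]`
  set 𝔮' : Ideal (MvPolynomial σ ℚ) := 𝔮.map (algebraMap (MvPolynomial σ ℤ) (MvPolynomial σ ℚ)) with h𝔮'
  have h𝔮'P : 𝔮'.IsPrime := IsLocalization.isPrime_of_isPrime_disjoint M (MvPolynomial σ ℚ) 𝔮 h𝔮 hdisj
  have hS𝔮' : Ideal.span ((MvPolynomial.map (Int.castRingHom ℚ)) '' S) ≤ 𝔮' := by
    rw [← halg, ← Ideal.map_span]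
    exact Ideal.map_mono hS𝔮
  have h𝔮'𝔭 : 𝔮' ≤ 𝔭 := by
    have h := Ideal.map_mono (f := algebraMap (MvPolynomial σ ℤ) (MvPolynomial σ ℚ))
      (show 𝔮 ≤ 𝔭.under (MvPolynomial σ ℤ) by rw [hunder]; exact h𝔮𝔭)
    rw [IsLocalization.map_under M (MvPolynomial σ ℚ) 𝔭] at h
    exact h
  have heq : 𝔮' = 𝔭 := le_antisymm h𝔮'𝔭 (h𝔭.2 ⟨h𝔮'P, hS𝔮'⟩ h𝔮'𝔭)
  have hback : 𝔮'.under (MvPolynomial σ ℤ) = 𝔮 :=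
    IsLocalization.under_map_of_isPrime_disjoint M (MvPolynomial σ ℚ) h𝔮 hdisj
  rw [← hback, heq, hunder]

/-- **Minimality transport along a ring isomorphism**, in the form consumed by
`exists_parametrisation` / `eliminant_identity`: for `Γ : ℤ[Y] ≃ B`, `S' = Γ(S)` and
`φ' = π ∘ Γ⁻¹` with `ker π = 𝔭 ∩ ℤ[Y]`, every prime `𝔮` of `B` with `(S') ≤ 𝔮 ≤ ker φ'` equals
`ker φ'`. -/
theorem ringEquiv_minimal_transport {B F : Type*} [CommRing B] [CommRing F] {t : ℕ}
    (S : Fin t → MvPolynomial σ ℤ) (𝔭 : Ideal (MvPolynomial σ ℚ))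
    (h𝔭 : 𝔭 ∈ (Ideal.span (Set.range fun k => MvPolynomial.map (Int.castRingHom ℚ) (S k))).minimalPrimes)
    (π : MvPolynomial σ ℤ →+* F)
    (hπ : RingHom.ker π = 𝔭.comap (MvPolynomial.map (Int.castRingHom ℚ)))
    (Γ : MvPolynomial σ ℤ ≃+* B) :
    ∀ 𝔮 : Ideal B, 𝔮.IsPrime → Ideal.span (Set.range fun k => Γ (S k)) ≤ 𝔮 →
      𝔮 ≤ RingHom.ker (π.comp Γ.symm.toRingHom) → 𝔮 = RingHom.ker (π.comp Γ.symm.toRingHom) := by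
  intro 𝔮 h𝔮 hS𝔮 h𝔮ker
  have hid : Γ.toRingHom.comp Γ.symm.toRingHom = RingHom.id B := by
    ext x; simp
  have himg : (Set.range fun k => MvPolynomial.map (Int.castRingHom ℚ) (S k)) =
      (MvPolynomial.map (Int.castRingHom ℚ)) '' (Set.range S) := by
    rw [← Set.range_comp]; rfl
  rw [himg] at h𝔭
  -- pull `𝔮` back to `ℤ[Y]`
  set 𝔮₀ : Ideal (MvPolynomial σ ℤ) := 𝔮.comap Γ.toRingHom with h𝔮₀
  have h𝔮₀P : 𝔮₀.IsPrime := Ideal.comap_isPrime _ _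
  have hS𝔮₀ : Ideal.span (Set.range S) ≤ 𝔮₀ := by
    rw [Ideal.span_le]
    rintro _ ⟨k, rfl⟩
    rw [h𝔮₀, SetLike.mem_coe, Ideal.mem_comap]
    exact hS𝔮 (Ideal.subset_span ⟨k, rfl⟩)
  have h𝔮₀𝔭 : 𝔮₀ ≤ 𝔭.comap (MvPolynomial.map (Int.castRingHom ℚ)) := by
    intro x hx
    rw [← hπ, RingHom.mem_ker]
    have hx' : Γ x ∈ 𝔮 := hx
    have := h𝔮ker hx'
    rw [RingHom.mem_ker, RingHom.comp_apply] at this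
    simpa using this
  have h := eq_comap_of_le_comap_of_minimal (Set.range S) 𝔭 h𝔭 𝔮₀ h𝔮₀P hS𝔮₀ h𝔮₀𝔭
  -- push forward again
  rw [← RingHom.comap_ker, hπ, ← h, h𝔮₀, Ideal.comap_comap, hid]
  ext x
  simp only [Ideal.mem_comap, RingHom.id_apply]

end Summit.ValiantsHypothesis.ValiantsHypothesis.Theorems.LangWeilTransfer
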